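import Mathlib
import HarnessLib
import Summits.HubbardSuperconductivity.HubbardSuperconductivity.Theorems.WeakCouplingBCSKlCertDOSQuadratureIntegral

/-!
# Route `WeakCouplingBCS` — support item `WcbcsKohnLuttingerB1g` (stmt-HubbardSuperconductivity-0158):
# kernel-checkable quadrature of `∫ w_μ · Φ²` for a tabulated trigonometric trial `Φ` (R2dCERT rung R3 = rows E1 of the record)

Continuation of `WeakCouplingBCSKlCertDOSQuadrature(Integral).lean` (cell gate-hubbard-kl, HOME/eng/ENCLOSURES-SCOPE.md (c) R3).  The Ritz
norm of a certificate block is `∫ Φ² dσ_μ = ∫_{(-π,π]} w_μ(θ) (t.eval θ)² dθ` (`klpt_integral_trialFun_sq`), `t : KLTrig` the tabulated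
trigonometric polynomial `Σ a_j cos(jθ) + Σ b_j sin(jθ)`.  This file adds to the `DOSCell` checker a per-cell bracket of `(t.eval θ)²`:

* `qEval t x` — `t.eval` at a rational point with every `cos(jx)`, `sin(jx)` replaced by the INTERVAL `[qCosT (M+1) (jx), qCosT M (jx)]`, `M = 8 + 2⌊jx⌋`
  (adaptive order because `jx` reaches `22 · π/4 ≈ 17`; exact rational arithmetic has no cancellation loss): `qEvalLo t x ≤ t.eval x ≤ qEvalHi t x`
  (`qEvalLo_le`, `le_qEvalHi`; the sine part requires `x ≥ 0`);
* `lipConst t = Σ |a_j| j + Σ |b_j| j` — a Lipschitz constant of `t.eval` (`abs_eval_sub_eval_le`, from Mathlib's `abs_cos_sub_cos_le`);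
* `TrigCell` = a `DOSCell` (it re-uses its certificate `DOSCell.ok`); on it `evalLo/evalHi` = midpoint enclosure `∓ lipConst · (b-a)/2`,
  `sqLo/sqHi` the induced bracket of the square, `gLo = wLo·sqLo`, `gHi = wHi·sqHi`; soundness **`TrigCell.g_mem`**:
  `ok → ∀ θ ∈ [a,b], gLo ≤ w_μ(θ) (t.eval θ)² ≤ gHi`;
* (companion file `WeakCouplingBCSKlCertTrigQuadratureChain.lean`: chains `tLowerSum / tUpperSum` + `tchain_bounds`, the chunking lemmas,
  the `D₄` reduction `integral_eq_eight_mul_of_symm` / `integral_g_eq_eight_mul`, and `quarter_tintegral_mem`).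

Everything is proved; definitions are the checker's rational bookkeeping. [folklore]
-/

noncomputable section

-- the tree's namespace `Summit.<Summit>.<Problem>.Theorems` repeats the summit name by design (D-0017)
set_option linter.dupNamespace false

namespace Summit.HubbardSuperconductivity.HubbardSuperconductivity.Theorems.KlCertQuad

open Real Set MeasureTheory intervalIntegral CwKLChiralWindow Literature.MathematicalPhysics.QuantumLattice

/-! ### Interval evaluation of a tabulated trigonometric polynomial at a rational point -/

/-- Taylor order used at the argument `y ≥ 0`: `8 + 2⌊y⌋` (even; the error `y^{2M+2}/(2M+2)!` is then `≤ 10⁻⁹` up to `y ≈ 20`).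
[folklore] -/
def tOrd (y : ℚ) : ℕ := 8 + 2 * ⌊y⌋₊

/-- `tOrd y` is even. [folklore] -/
theorem even_tOrd (y : ℚ) : Even (tOrd y) := ⟨4 + ⌊y⌋₊, by unfold tOrd; ring⟩

/-- `tOrd y + 1` is odd. [folklore] -/
theorem odd_tOrd_succ (y : ℚ) : Odd (tOrd y + 1) := (even_tOrd y).add_one

/-- Adaptive-order lower enclosure of `cos y`. [folklore] -/
def cosLoA (y : ℚ) : ℚ := qCosT (tOrd y + 1) y
/-- Adaptive-order upper enclosure of `cos y`. [folklore] -/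
def cosHiA (y : ℚ) : ℚ := qCosT (tOrd y) y
/-- Adaptive-order lower enclosure of `sin y`, `y ≥ 0`. [folklore] -/
def sinLoA (y : ℚ) : ℚ := qSinT (tOrd y + 1) y
/-- Adaptive-order upper enclosure of `sin y`, `y ≥ 0`. [folklore] -/
def sinHiA (y : ℚ) : ℚ := qSinT (tOrd y) y

/-- `cosLoA y ≤ cos y`. [folklore] -/
theorem cosLoA_le (y : ℚ) : ((cosLoA y : ℚ) : ℝ) ≤ Real.cos y := by
  rw [cosLoA, cast_qCosT]; exact Literature.Computability.MetaComplexity.cosTaylorSum_le_cos (odd_tOrd_succ y) _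
/-- `cos y ≤ cosHiA y`. [folklore] -/
theorem le_cosHiA (y : ℚ) : Real.cos y ≤ ((cosHiA y : ℚ) : ℝ) := by
  rw [cosHiA, cast_qCosT]; exact Literature.Computability.MetaComplexity.cos_le_cosTaylorSum (even_tOrd y) _
/-- `sinLoA y ≤ sin y` for `y ≥ 0`. [folklore] -/
theorem sinLoA_le {y : ℚ} (hy : 0 ≤ y) : ((sinLoA y : ℚ) : ℝ) ≤ Real.sin y := by
  rw [sinLoA, cast_qSinT]
  exact Literature.Computability.MetaComplexity.sinTaylorSum_le_sin (odd_tOrd_succ y) (by exact_mod_cast hy)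
/-- `sin y ≤ sinHiA y` for `y ≥ 0`. [folklore] -/
theorem le_sinHiA {y : ℚ} (hy : 0 ≤ y) : Real.sin y ≤ ((sinHiA y : ℚ) : ℝ) := by
  rw [sinHiA, cast_qSinT]
  exact Literature.Computability.MetaComplexity.sin_le_sinTaylorSum (even_tOrd y) (by exact_mod_cast hy)

/-- Lower enclosure of `c · cos y`, by the sign of `c`. [folklore] -/
def mulCosLo (c y : ℚ) : ℚ := if 0 ≤ c then c * cosLoA y else c * cosHiA y
/-- Upper enclosure of `c · cos y`. [folklore] -/
def mulCosHi (c y : ℚ) : ℚ := if 0 ≤ c then c * cosHiA y else c * cosLoA y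
/-- Lower enclosure of `c · sin y`, `y ≥ 0`. [folklore] -/
def mulSinLo (c y : ℚ) : ℚ := if 0 ≤ c then c * sinLoA y else c * sinHiA y
/-- Upper enclosure of `c · sin y`, `y ≥ 0`. [folklore] -/
def mulSinHi (c y : ℚ) : ℚ := if 0 ≤ c then c * sinHiA y else c * sinLoA y

/-- Soundness of `mulCosLo`. [folklore] -/
theorem mulCosLo_le (c y : ℚ) : ((mulCosLo c y : ℚ) : ℝ) ≤ (c : ℝ) * Real.cos y := by
  unfold mulCosLo
  have h27 := cosLoA_le y
  have h28 := le_cosHiA y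
  split_ifs with hc
  · push_cast; exact mul_le_mul_of_nonneg_left h27 (by exact_mod_cast hc)
  · push_cast; exact mul_le_mul_of_nonpos_left h28 (by push_cast [not_le] at hc; exact_mod_cast hc.le)

/-- Soundness of `mulCosHi`. [folklore] -/
theorem le_mulCosHi (c y : ℚ) : (c : ℝ) * Real.cos y ≤ ((mulCosHi c y : ℚ) : ℝ) := by
  unfold mulCosHi
  have h27 := cosLoA_le y
  have h28 := le_cosHiA y
  split_ifs with hc
  · push_cast; exact mul_le_mul_of_nonneg_left h28 (by exact_mod_cast hc)
  · push_cast; exact mul_le_mul_of_nonpos_left h27 (by push_cast [not_le] at hc; exact_mod_cast hc.le)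

/-- Soundness of `mulSinLo`. [folklore] -/
theorem mulSinLo_le (c : ℚ) {y : ℚ} (hy : 0 ≤ y) : ((mulSinLo c y : ℚ) : ℝ) ≤ (c : ℝ) * Real.sin y := by
  unfold mulSinLo
  have h27 := sinLoA_le hy
  have h28 := le_sinHiA hy
  split_ifs with hc
  · push_cast; exact mul_le_mul_of_nonneg_left h27 (by exact_mod_cast hc)
  · push_cast; exact mul_le_mul_of_nonpos_left h28 (by push_cast [not_le] at hc; exact_mod_cast hc.le)

/-- Soundness of `mulSinHi`. [folklore] -/
theorem le_mulSinHi (c : ℚ) {y : ℚ} (hy : 0 ≤ y) : (c : ℝ) * Real.sin y ≤ ((mulSinHi c y : ℚ) : ℝ) := by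
  unfold mulSinHi
  have h27 := sinLoA_le hy
  have h28 := le_sinHiA hy
  split_ifs with hc
  · push_cast; exact mul_le_mul_of_nonneg_left h28 (by exact_mod_cast hc)
  · push_cast; exact mul_le_mul_of_nonpos_left h27 (by push_cast [not_le] at hc; exact_mod_cast hc.le)

/-- Lower interval evaluation of a coefficient list of cosines at the rational point `x`. [folklore] -/
def cosListLo (L : List (ℕ × ℚ)) (x : ℚ) : ℚ := (L.map fun p => mulCosLo p.2 (p.1 * x)).sum
/-- Upper interval evaluation of a coefficient list of cosines. [folklore] -/
def cosListHi (L : List (ℕ × ℚ)) (x : ℚ) : ℚ := (L.map fun p => mulCosHi p.2 (p.1 * x)).sum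
/-- Lower interval evaluation of a coefficient list of sines (`x ≥ 0`). [folklore] -/
def sinListLo (L : List (ℕ × ℚ)) (x : ℚ) : ℚ := (L.map fun p => mulSinLo p.2 (p.1 * x)).sum
/-- Upper interval evaluation of a coefficient list of sines (`x ≥ 0`). [folklore] -/
def sinListHi (L : List (ℕ × ℚ)) (x : ℚ) : ℚ := (L.map fun p => mulSinHi p.2 (p.1 * x)).sum

/-- Soundness of `cosListLo`. [folklore] -/
theorem cosListLo_le (L : List (ℕ × ℚ)) (x : ℚ) :
    ((cosListLo L x : ℚ) : ℝ) ≤ (L.map fun p : ℕ × ℚ => (p.2 : ℝ) * Real.cos ((p.1 : ℝ) * x)).sum := by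
  induction L with
  | nil => simp [cosListLo]
  | cons p L ih =>
    simp only [cosListLo, List.map_cons, List.sum_cons, Rat.cast_add] at ih ⊢
    refine add_le_add ?_ ih
    have := mulCosLo_le p.2 (p.1 * x); push_cast at this; exact this

/-- Soundness of `cosListHi`. [folklore] -/
theorem le_cosListHi (L : List (ℕ × ℚ)) (x : ℚ) :
    (L.map fun p : ℕ × ℚ => (p.2 : ℝ) * Real.cos ((p.1 : ℝ) * x)).sum ≤ ((cosListHi L x : ℚ) : ℝ) := by
  induction L with
  | nil => simp [cosListHi]
  | cons p L ih =>
    simp only [cosListHi, List.map_cons, List.sum_cons, Rat.cast_add] at ih ⊢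
    refine add_le_add ?_ ih
    have := le_mulCosHi p.2 (p.1 * x); push_cast at this; exact this

/-- Soundness of `sinListLo`. [folklore] -/
theorem sinListLo_le (L : List (ℕ × ℚ)) {x : ℚ} (hx : 0 ≤ x) :
    ((sinListLo L x : ℚ) : ℝ) ≤ (L.map fun p : ℕ × ℚ => (p.2 : ℝ) * Real.sin ((p.1 : ℝ) * x)).sum := by
  induction L with
  | nil => simp [sinListLo]
  | cons p L ih =>
    simp only [sinListLo, List.map_cons, List.sum_cons, Rat.cast_add] at ih ⊢
    refine add_le_add ?_ ih
    have := mulSinLo_le p.2 (y := p.1 * x) (by positivity); push_cast at this; exact this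

/-- Soundness of `sinListHi`. [folklore] -/
theorem le_sinListHi (L : List (ℕ × ℚ)) {x : ℚ} (hx : 0 ≤ x) :
    (L.map fun p : ℕ × ℚ => (p.2 : ℝ) * Real.sin ((p.1 : ℝ) * x)).sum ≤ ((sinListHi L x : ℚ) : ℝ) := by
  induction L with
  | nil => simp [sinListHi]
  | cons p L ih =>
    simp only [sinListHi, List.map_cons, List.sum_cons, Rat.cast_add] at ih ⊢
    refine add_le_add ?_ ih
    have := le_mulSinHi p.2 (y := p.1 * x) (by positivity); push_cast at this; exact this

/-- Lower interval evaluation of `t.eval` at a rational point `x ≥ 0`. [folklore] -/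
def qEvalLo (t : KLTrig) (x : ℚ) : ℚ := cosListLo t.cosC x + sinListLo t.sinC x
/-- Upper interval evaluation of `t.eval` at a rational point `x ≥ 0`. [folklore] -/
def qEvalHi (t : KLTrig) (x : ℚ) : ℚ := cosListHi t.cosC x + sinListHi t.sinC x

/-- Soundness of `qEvalLo`. [folklore] -/
theorem qEvalLo_le (t : KLTrig) {x : ℚ} (hx : 0 ≤ x) : ((qEvalLo t x : ℚ) : ℝ) ≤ t.eval x := by
  rw [qEvalLo, KLTrig.eval]; push_cast
  exact add_le_add (cosListLo_le _ _) (sinListLo_le _ hx)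

/-- Soundness of `qEvalHi`. [folklore] -/
theorem le_qEvalHi (t : KLTrig) {x : ℚ} (hx : 0 ≤ x) : t.eval x ≤ ((qEvalHi t x : ℚ) : ℝ) := by
  rw [qEvalHi, KLTrig.eval]; push_cast
  exact add_le_add (le_cosListHi _ _) (le_sinListHi _ hx)

/-! ### A Lipschitz constant of `t.eval` -/

/-- `Σ |a_j| j` over a coefficient list. [folklore] -/
def lipList (L : List (ℕ × ℚ)) : ℚ := (L.map fun p => |p.2| * (p.1 : ℚ)).sum
/-- `lipConst t = Σ |a_j| j + Σ |b_j| j` — a Lipschitz constant of `θ ↦ t.eval θ`. [folklore] -/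
def lipConst (t : KLTrig) : ℚ := lipList t.cosC + lipList t.sinC

/-- Lipschitz bound for a cosine list. [folklore] -/
theorem abs_cosList_sub_le (L : List (ℕ × ℚ)) (x y : ℝ) :
    |(L.map fun p : ℕ × ℚ => (p.2 : ℝ) * Real.cos ((p.1 : ℝ) * x)).sum -
      (L.map fun p : ℕ × ℚ => (p.2 : ℝ) * Real.cos ((p.1 : ℝ) * y)).sum| ≤ ((lipList L : ℚ) : ℝ) * |x - y| := by
  induction L with
  | nil => simp [lipList]
  | cons p L ih =>
    simp only [List.map_cons, List.sum_cons, lipList] at ih ⊢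
    push_cast at ih ⊢
    set A := (p.2 : ℝ) * Real.cos ((p.1 : ℝ) * x)
    set B := (p.2 : ℝ) * Real.cos ((p.1 : ℝ) * y)
    set C := (L.map fun p : ℕ × ℚ => (p.2 : ℝ) * Real.cos ((p.1 : ℝ) * x)).sum
    set D := (L.map fun p : ℕ × ℚ => (p.2 : ℝ) * Real.cos ((p.1 : ℝ) * y)).sum
    have h1 : |A - B| ≤ |(p.2 : ℝ)| * p.1 * |x - y| := by
      simp only [A, B]
      rw [← mul_sub, abs_mul, mul_assoc]
      refine mul_le_mul_of_nonneg_left ?_ (abs_nonneg _)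
      refine (Real.abs_cos_sub_cos_le _ _).trans ?_
      rw [← mul_sub, abs_mul, abs_of_nonneg (by positivity : (0 : ℝ) ≤ p.1)]
    have hsplit : A + C - (B + D) = (A - B) + (C - D) := by ring
    rw [hsplit]
    refine (abs_add_le _ _).trans ?_
    nlinarith [h1, ih, abs_nonneg (x - y)]

/-- Lipschitz bound for a sine list. [folklore] -/
theorem abs_sinList_sub_le (L : List (ℕ × ℚ)) (x y : ℝ) :
    |(L.map fun p : ℕ × ℚ => (p.2 : ℝ) * Real.sin ((p.1 : ℝ) * x)).sum -
      (L.map fun p : ℕ × ℚ => (p.2 : ℝ) * Real.sin ((p.1 : ℝ) * y)).sum| ≤ ((lipList L : ℚ) : ℝ) * |x - y| := by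
  induction L with
  | nil => simp [lipList]
  | cons p L ih =>
    simp only [List.map_cons, List.sum_cons, lipList] at ih ⊢
    push_cast at ih ⊢
    set A := (p.2 : ℝ) * Real.sin ((p.1 : ℝ) * x)
    set B := (p.2 : ℝ) * Real.sin ((p.1 : ℝ) * y)
    set C := (L.map fun p : ℕ × ℚ => (p.2 : ℝ) * Real.sin ((p.1 : ℝ) * x)).sum
    set D := (L.map fun p : ℕ × ℚ => (p.2 : ℝ) * Real.sin ((p.1 : ℝ) * y)).sum
    have h1 : |A - B| ≤ |(p.2 : ℝ)| * p.1 * |x - y| := by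
      simp only [A, B]
      rw [← mul_sub, abs_mul, mul_assoc]
      refine mul_le_mul_of_nonneg_left ?_ (abs_nonneg _)
      refine (Real.abs_sin_sub_sin_le _ _).trans ?_
      rw [← mul_sub, abs_mul, abs_of_nonneg (by positivity : (0 : ℝ) ≤ p.1)]
    have hsplit : A + C - (B + D) = (A - B) + (C - D) := by ring
    rw [hsplit]
    refine (abs_add_le _ _).trans ?_
    nlinarith [h1, ih, abs_nonneg (x - y)]

/-- **`t.eval` is `lipConst t`-Lipschitz.** [folklore] -/
theorem abs_eval_sub_eval_le (t : KLTrig) (x y : ℝ) : |t.eval x - t.eval y| ≤ ((lipConst t : ℚ) : ℝ) * |x - y| := by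
  have h1 := abs_cosList_sub_le t.cosC x y
  have h2 := abs_sinList_sub_le t.sinC x y
  rw [KLTrig.eval, KLTrig.eval, lipConst]
  push_cast
  set A := (t.cosC.map fun p : ℕ × ℚ => (p.2 : ℝ) * Real.cos ((p.1 : ℝ) * x)).sum
  set B := (t.cosC.map fun p : ℕ × ℚ => (p.2 : ℝ) * Real.cos ((p.1 : ℝ) * y)).sum
  set C := (t.sinC.map fun p : ℕ × ℚ => (p.2 : ℝ) * Real.sin ((p.1 : ℝ) * x)).sum
  set D := (t.sinC.map fun p : ℕ × ℚ => (p.2 : ℝ) * Real.sin ((p.1 : ℝ) * y)).sum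
  have hsplit : A + C - (B + D) = (A - B) + (C - D) := by ring
  rw [hsplit]
  refine (abs_add_le _ _).trans ?_
  linarith

/-! ### The per-cell bracket of `w_μ · (t.eval)²` -/

namespace DOSCell

variable (c : DOSCell) (t : KLTrig)

/-- Midpoint of the cell. [folklore] -/
def mid : ℚ := (c.a + c.b) / 2
/-- Lower bracket of `t.eval` on the cell: midpoint enclosure minus the Lipschitz pad. [folklore] -/
def evalLo : ℚ := qEvalLo t c.mid - lipConst t * ((c.b - c.a) / 2)
/-- Upper bracket of `t.eval` on the cell. [folklore] -/
def evalHi : ℚ := qEvalHi t c.mid + lipConst t * ((c.b - c.a) / 2)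
/-- Lower bracket of `(t.eval)²` on the cell. [folklore] -/
def sqLo : ℚ := if c.evalLo t ≤ 0 ∧ 0 ≤ c.evalHi t then 0 else min (c.evalLo t ^ 2) (c.evalHi t ^ 2)
/-- Upper bracket of `(t.eval)²` on the cell. [folklore] -/
def sqHi : ℚ := max (c.evalLo t ^ 2) (c.evalHi t ^ 2)
/-- Lower bracket of `w_μ · (t.eval)²` on the cell. [folklore] -/
def gLo : ℚ := c.wLo * c.sqLo t
/-- Upper bracket of `w_μ · (t.eval)²` on the cell. [folklore] -/
def gHi : ℚ := c.wHi * c.sqHi t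

end DOSCell

section TrigSound

variable {μq : ℚ} (hμ₁ : -4 < ((μq : ℚ) : ℝ)) (hμ₂ : ((μq : ℚ) : ℝ) < 0) {c : DOSCell} (hc : c.ok μq = true) (t : KLTrig)
  {θ : ℝ} (hθa : ((c.a : ℚ) : ℝ) ≤ θ) (hθb : θ ≤ ((c.b : ℚ) : ℝ))
include hc hθa hθb

omit hc in
/-- `t.eval θ ∈ [evalLo, evalHi]` on the cell (for cells in `[0, ∞)`). [folklore] -/
theorem DOSCell.eval_mem (ha : 0 ≤ c.a) :
    ((c.evalLo t : ℚ) : ℝ) ≤ t.eval θ ∧ t.eval θ ≤ ((c.evalHi t : ℚ) : ℝ) := by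
  have hm0 : 0 ≤ c.mid := by
    have : ((c.a : ℚ) : ℝ) ≤ c.b := hθa.trans hθb
    have hab : c.a ≤ c.b := by exact_mod_cast this
    unfold DOSCell.mid; linarith
  have hlo := qEvalLo_le t hm0
  have hhi := le_qEvalHi t hm0
  have hlip := abs_eval_sub_eval_le t θ (c.mid : ℚ)
  have hdist : |θ - ((c.mid : ℚ) : ℝ)| ≤ (((c.b - c.a) / 2 : ℚ) : ℝ) := by
    rw [DOSCell.mid]; push_cast; rw [abs_le]; constructor <;> linarith
  have hL0 : (0 : ℝ) ≤ ((lipConst t : ℚ) : ℝ) := by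
    have : |t.eval θ - t.eval θ| ≤ ((lipConst t : ℚ) : ℝ) * |θ - θ| := abs_eval_sub_eval_le t θ θ
    have h1 := abs_eval_sub_eval_le t 1 0
    have : (0 : ℝ) ≤ ((lipConst t : ℚ) : ℝ) * |(1 : ℝ) - 0| := (abs_nonneg _).trans h1
    simpa using this
  have hpad := mul_le_mul_of_nonneg_left hdist hL0
  rw [abs_le] at hlip
  rw [DOSCell.evalLo, DOSCell.evalHi]
  push_cast at hpad ⊢
  constructor <;> linarith [hlip.1, hlip.2]

/-- `(t.eval θ)² ∈ [sqLo, sqHi]` on the cell. [folklore] -/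
theorem DOSCell.sq_mem :
    ((c.sqLo t : ℚ) : ℝ) ≤ t.eval θ ^ 2 ∧ t.eval θ ^ 2 ≤ ((c.sqHi t : ℚ) : ℝ) := by
  obtain ⟨⟨ha0, -, -⟩, -⟩ := DOSCell.ok_spec hc
  obtain ⟨hlo, hhi⟩ := DOSCell.eval_mem t hθa hθb ha0
  constructor
  · unfold DOSCell.sqLo
    split_ifs with h
    · push_cast; positivity
    · rw [not_and_or, not_le, not_le] at h
      rcases h with h | h
      · -- `0 < evalLo ≤ e`
        have hL : (0 : ℝ) < ((c.evalLo t : ℚ) : ℝ) := by exact_mod_cast h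
        push_cast
        exact (min_le_left _ _).trans (by nlinarith)
      · -- `e ≤ evalHi < 0`
        have hH : ((c.evalHi t : ℚ) : ℝ) < 0 := by exact_mod_cast h
        push_cast
        exact (min_le_right _ _).trans (by nlinarith)
  · unfold DOSCell.sqHi
    push_cast
    rcases le_total 0 (t.eval θ) with he | he
    · exact le_trans (by nlinarith) (le_max_right _ _)
    · exact le_trans (by nlinarith) (le_max_left _ _)

include hμ₁ hμ₂ in
/-- **Soundness of the cell bracket for `w_μ · Φ²`**: `gLo ≤ w_μ(θ) (t.eval θ)² ≤ gHi` on the cell. [folklore] -/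
theorem DOSCell.g_mem :
    ((c.gLo t : ℚ) : ℝ) ≤ fermiPolarDOS μq θ * t.eval θ ^ 2 ∧
      fermiPolarDOS μq θ * t.eval θ ^ 2 ≤ ((c.gHi t : ℚ) : ℝ) := by
  obtain ⟨hw₁, hw₂⟩ := DOSCell.dos_mem hμ₁ hμ₂ hc hθa hθb
  obtain ⟨hs₁, hs₂⟩ := DOSCell.sq_mem hc t hθa hθb
  obtain ⟨-, -, ⟨hulo0, -, -⟩, -, -, ⟨-, -, hDt0⟩⟩ := DOSCell.ok_spec hc
  have hw0 : 0 ≤ fermiPolarDOS (μq : ℝ) θ := (fermiPolarDOS_pos hμ₁ hμ₂ θ).le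
  have hwLo0 : (0 : ℝ) ≤ ((c.wLo : ℚ) : ℝ) := by
    -- `wLo = ulo/DtHi` with `ulo > 0`, and `DtHi ≥ Dt ≥ DtLo > 0`
    obtain ⟨hD₁, hD₂⟩ := DOSCell.Dt_mem hμ₁ hμ₂ hc hθa hθb
    have : (0 : ℝ) < c.DtHi := lt_of_lt_of_le (by exact_mod_cast hDt0) (hD₁.trans hD₂)
    rw [DOSCell.wLo]; push_cast; exact div_nonneg (by exact_mod_cast hulo0.le) this.le
  have hsq0 : (0 : ℝ) ≤ ((c.sqLo t : ℚ) : ℝ) := by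
    unfold DOSCell.sqLo; split_ifs <;> push_cast <;> [exact le_rfl; exact le_min (sq_nonneg _) (sq_nonneg _)]
  rw [DOSCell.gLo, DOSCell.gHi]
  push_cast
  constructor
  · exact mul_le_mul hw₁ hs₁ hsq0 hw0
  · exact mul_le_mul hw₂ hs₂ (sq_nonneg _) (hw0.trans hw₂)

end TrigSound

end Summit.HubbardSuperconductivity.HubbardSuperconductivity.Theorems.KlCertQuad

end
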